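import Literature.Probability.LatticeModels.IsoradialSquareGrid
import Literature.Probability.LatticeModels.IsoradialPercolation
import HarnessLib

/-!
# Reflecting a rhombic embedding in the diagonal: horizontal and vertical crossings exchanged

Bookkeeping for the H21 rendering of the box-crossing property (`BoxCrossingBounds`,
`embRectCrossing`, `embTBCrossing` of `Literature.Probability.LatticeModels.IsoradialPercolation`),
which treats horizontal crossings of `w + [0, ρ n] × [0, n]` and vertical crossings of
`w + [0, n] × [0, ρ n]` separately: the reflection `x + i y ↦ y + i x` of the plane carries the
one kind of event to the other, and it carries an isoradial rhombic embedding to an isoradial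
rhombic embedding of the *same graph with the same faces and the same canonical measure*
(Grimmett–Manolescu, PTRF 159 (2014), §2.3: the box-crossing property is formulated for all
rotations; Def. 2.2). So every statement about horizontal crossings proved for all isoradial
embeddings yields its vertical counterpart for free.

* `swapXY`, an involutive isometry of `ℂ` fixing `|arg|` of quotients (`abs_arg_div_swapXY`);
* `RhombicEmbedding.reflect` — the reflected embedding (`z`, `c` composed with `swapXY`, faces
  unchanged) and its invariants: `halfAngle_reflect`, `IsIsoradial.reflect`,
  `HasBoundedAngles.reflect`, `edgeWeight_reflect`, `isoradialPercolation_reflect` (same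
  measure), `isTrack_reflect_iff`, `IsSquareGridGM.reflect`, `SquareGridPropertyGM.reflect`;
* `embTBCrossing_eq_embRectCrossing_reflect`, `embRectCrossing_eq_embTBCrossing_reflect` — the
  event identities, with translations.

The tiling condition (`IsRhombicTiling`, stated in `Literature.Probability.Percolation.Isoradial`)
is transported in the `Percolation` companion files, where it is used.

## References

* G. R. Grimmett, I. Manolescu, *Bond percolation on isoradial graphs: criticality and
  universality*, PTRF 159 (2014) 273–327, arXiv:1204.0505, §2.3 (Def. 2.2: rectangles in all
  orientations; reduction to horizontal/vertical boxes).
-/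

noncomputable section

namespace Literature.Probability.LatticeModels

open Complex ComplexConjugate

/-! ### The reflection `x + iy ↦ y + ix` -/

/-- The reflection of the plane in the diagonal `re = im`: `x + i y ↦ y + i x`. [folklore] -/
def swapXY (w : ℂ) : ℂ := ⟨w.im, w.re⟩

/-- Real part after reflection. [folklore] -/
@[simp] theorem swapXY_re (w : ℂ) : (swapXY w).re = w.im := rfl

/-- Imaginary part after reflection. [folklore] -/
@[simp] theorem swapXY_im (w : ℂ) : (swapXY w).im = w.re := rfl

/-- The reflection is an involution. [folklore] -/
@[simp] theorem swapXY_swapXY (w : ℂ) : swapXY (swapXY w) = w := rfl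

/-- The reflection is `w ↦ i · conj w`. [folklore] -/
theorem swapXY_eq (w : ℂ) : swapXY w = I * conj w := by
  apply Complex.ext <;> simp [swapXY]

/-- The reflection is additive. [folklore] -/
theorem swapXY_sub (w w' : ℂ) : swapXY (w - w') = swapXY w - swapXY w' := by
  apply Complex.ext <;> simp [swapXY]

/-- The reflection is an isometry. [folklore] -/
@[simp] theorem norm_swapXY (w : ℂ) : ‖swapXY w‖ = ‖w‖ := by
  rw [swapXY_eq, norm_mul, Complex.norm_I, one_mul, Complex.norm_conj]

/-- The reflection is injective. [folklore] -/
theorem swapXY_injective : Function.Injective swapXY := fun w w' h => by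
  rw [← swapXY_swapXY w, h, swapXY_swapXY]

/-- Quotients of reflected differences are conjugates of the original quotients. [folklore] -/
theorem swapXY_div_swapXY (u v : ℂ) : swapXY u / swapXY v = conj (u / v) := by
  rw [swapXY_eq, swapXY_eq, map_div₀]
  by_cases hv : v = 0
  · simp [hv]
  · have : conj v ≠ 0 := (map_ne_zero _).2 hv
    field_simp

/-- **Reflection preserves unsigned angles**: `|arg (swapXY u / swapXY v)| = |arg (u / v)|`
(`arg (conj x) = ± arg x`). [folklore] -/
theorem abs_arg_div_swapXY (u v : ℂ) : |arg (swapXY u / swapXY v)| = |arg (u / v)| := by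
  rw [swapXY_div_swapXY, arg_conj]
  split_ifs with h
  · rw [h]
  · rw [abs_neg]

/-! ### The reflected embedding -/

namespace RhombicEmbedding

variable {V : Type*} {G : SimpleGraph V} {F : Type*} (emb : RhombicEmbedding G F)

/-- **The reflected embedding**: vertices at `swapXY ∘ z`, face centres at `swapXY ∘ c`, the
faces of each dart unchanged (no orientation convention is imposed on `leftFace`/`rightFace`).
(Grimmett–Manolescu 2014, §2.3: isoradiality and the box-crossing property are invariant under
the isometries of the plane.) [folklore] -/
def reflect : RhombicEmbedding G F where
  z := swapXY ∘ emb.z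
  c := swapXY ∘ emb.c
  leftFace := emb.leftFace
  rightFace := emb.rightFace

/-- Vertex positions of the reflected embedding. [folklore] -/
@[simp] theorem reflect_z (v : V) : emb.reflect.z v = swapXY (emb.z v) := rfl

/-- Face centres of the reflected embedding. [folklore] -/
@[simp] theorem reflect_c (f : F) : emb.reflect.c f = swapXY (emb.c f) := rfl

/-- Faces are unchanged by reflection. [folklore] -/
@[simp] theorem reflect_leftFace (d : G.Dart) : emb.reflect.leftFace d = emb.leftFace d := rfl

/-- Faces are unchanged by reflection. [folklore] -/
@[simp] theorem reflect_rightFace (d : G.Dart) : emb.reflect.rightFace d = emb.rightFace d := rfl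

/-- Reflecting twice gives back the embedding. [folklore] -/
@[simp] theorem reflect_reflect : emb.reflect.reflect = emb := rfl

/-- **Half-angles are invariant under reflection.** [folklore] -/
@[simp] theorem halfAngle_reflect (d : G.Dart) : emb.reflect.halfAngle d = emb.halfAngle d := by
  simp only [halfAngle, reflect_c, reflect_leftFace, reflect_z, ← swapXY_sub, abs_arg_div_swapXY]

variable {emb}

/-- Isoradiality is invariant under reflection. [folklore] -/
theorem IsIsoradial.reflect (h : emb.IsIsoradial) : emb.reflect.IsIsoradial where
  norm_sub_eq_one d := by
    simpa only [reflect_z, reflect_c, reflect_leftFace, ← swapXY_sub, norm_swapXY] using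
      h.norm_sub_eq_one d
  leftFace_symm d := h.leftFace_symm d
  c_leftFace_ne d := fun h' => h.c_leftFace_ne d (swapXY_injective h')
  z_injective := swapXY_injective.comp h.z_injective

/-- The bounded-angles property is invariant under reflection. [folklore] -/
theorem HasBoundedAngles.reflect {ε : ℝ} (h : emb.HasBoundedAngles ε) :
    emb.reflect.HasBoundedAngles ε := fun d => by
  simpa only [halfAngle_reflect] using h d

variable (emb)

/-- The canonical edge weights are invariant under reflection. [folklore] -/
@[simp] theorem edgeWeight_reflect : emb.reflect.edgeWeight = emb.edgeWeight := by
  funext e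
  unfold edgeWeight
  split_ifs <;> simp

/-- **The canonical measure is invariant under reflection** (same graph, same weights).
[folklore] -/
@[simp] theorem isoradialPercolation_reflect :
    emb.reflect.isoradialPercolation = emb.isoradialPercolation := by
  unfold isoradialPercolation
  rw [edgeWeight_reflect]

section Tracks

variable [DecidableEq V] [DecidableEq F]

/-- Sides of rhombi (corner–centre pairs) are unchanged by reflection. [folklore] -/
@[simp] theorem sides_reflect (e : G.edgeSet) : emb.reflect.sides e = emb.sides e := rfl

/-- Opposite sides are unchanged by reflection. [folklore] -/
@[simp] theorem oppositeSide_reflect (e : G.edgeSet) :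
    emb.reflect.oppositeSide e = emb.oppositeSide e := rfl

/-- Tracks are unchanged by reflection. [folklore] -/
theorem isTrack_reflect_iff (r : ℤ → G.edgeSet) : emb.reflect.IsTrack r ↔ emb.IsTrack r :=
  Iff.rfl

/-- Simple tracks are unchanged by reflection. [folklore] -/
theorem isSimpleTrack_reflect_iff (r : ℤ → G.edgeSet) :
    emb.reflect.IsSimpleTrack r ↔ emb.IsSimpleTrack r :=
  Iff.rfl

variable {emb}

/-- Printed square grids are unchanged by reflection. [folklore] -/
theorem IsSquareGridGM.reflect {s t : ℤ → ℤ → G.edgeSet} {I : ℕ} (h : emb.IsSquareGridGM s t I) :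
    emb.reflect.IsSquareGridGM s t I :=
  ⟨h.isSimpleTrack_left, h.isSimpleTrack_right, h.pairwise_not_trackMeets_left,
    h.pairwise_not_trackMeets_right, h.not_isReparametrization, h.crossesInOrder_left,
    h.crossesInOrder_right, h.encard_trackBetween_left_lt, h.encard_trackBetween_right_lt⟩

/-- SGP(I) is unchanged by reflection. [folklore] -/
theorem SquareGridPropertyGM.reflect {I : ℕ} (h : emb.SquareGridPropertyGM I) :
    emb.reflect.SquareGridPropertyGM I := by
  obtain ⟨s, t, hst⟩ := h
  exact ⟨s, t, hst.reflect⟩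

/-- The printed square-grid property is unchanged by reflection. [folklore] -/
theorem HasSquareGridPropertyGM.reflect (h : emb.HasSquareGridPropertyGM) :
    emb.reflect.HasSquareGridPropertyGM := by
  obtain ⟨I, hI⟩ := h
  exact ⟨I, hI.reflect⟩

end Tracks

end RhombicEmbedding

/-! ### Horizontal and vertical crossings are exchanged -/

section Events

variable {V : Type*}

/-- **A vertical crossing is a horizontal crossing of the reflected drawing**: the top–bottom
crossing of `w + [0, a] × [0, b]` by the drawing `z` is the left–right crossing of
`swapXY w + [0, b] × [0, a]` by the drawing `swapXY ∘ z` (the same event, as a set of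
configurations). [folklore] -/
theorem embTBCrossing_eq_embRectCrossing_reflect (z : V → ℂ) (w : ℂ) (a b : ℝ) :
    embTBCrossing (fun v => z v - w) a b =
      embRectCrossing (fun v => swapXY (z v) - swapXY w) b a := by
  unfold embTBCrossing embRectCrossing
  congr 1
  ext v
  simp only [Set.mem_setOf_eq, ← swapXY_sub, swapXY_re, swapXY_im, and_comm]

/-- **A horizontal crossing is a vertical crossing of the reflected drawing.** [folklore] -/
theorem embRectCrossing_eq_embTBCrossing_reflect (z : V → ℂ) (w : ℂ) (a b : ℝ) :
    embRectCrossing (fun v => z v - w) a b =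
      embTBCrossing (fun v => swapXY (z v) - swapXY w) b a := by
  unfold embTBCrossing embRectCrossing
  congr 1
  ext v
  simp only [Set.mem_setOf_eq, ← swapXY_sub, swapXY_re, swapXY_im, and_comm]

end Events

end Literature.Probability.LatticeModels

end
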